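import Summits.CriticalPhenomena.PercolationContinuityZ3.Theorems.SahiMasterFamilyPointwiseCoordinateGluing
import Mathlib.Tactic.Linarith
import Mathlib.Tactic.Ring
import HarnessLib

/-!
# `NoHeavyLowerTail` (crux stmt-CriticalPhenomena-4575), master-family line P2: the CHORD (Russo-type) IDENTITY of `E_3` along one coordinate for three
# ARBITRARY events of a product measure, in influence form and in pivotal-set form

Support file (seat `prim-masterthm-p2`, gen 10; `--supports stmt-CriticalPhenomena-4575`); no definition, no sorry.  Memo SAHI-ROUTE.md §4.32(c),(h); the
identity is master-conj's POINTWISE.md §15(b) ("exact, verified to 1e-15; not in the tree") = this seat's one-step identity; companion of the real-valued coin form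
`SahiCoordinateInfluence.sahiE_three_coinWeight` (p271029) and of `SahiCoordinateBernstein.sahiE_three_decomp_coord` (same chord, remainder left as abstract polynomial pieces).

For events `A, B, C ⊆ 2^ι` (no monotonicity needed), a product weight `μ_p` and a coordinate `e` with `t = p_e`, sections `X¹ = secAt e true X`, `X⁰ = secAt e false X`,
`m = μ_p`, influences `ν_X := m X¹ − m X⁰`, `ν_{XY} := m(X¹∩Y¹) − m(X⁰∩Y⁰)`:
* `sahiE_three_chord` — **`E_3(1_A,1_B,1_C) = (1−t)·E_3(1_{A⁰},1_{B⁰},1_{C⁰}) + t·E_3(1_{A¹},1_{B¹},1_{C¹}) + t(1−t)·G_e`**,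
  `G_e = Σ_cyc ν_A·ν_{BC} − Σ_cyc m(A)·ν_B ν_C − ((1−t) − t)·ν_A ν_B ν_C`   (`m(A) = t·mA¹ + (1−t)·mA⁰` expanded in the statement);
* `sahiE_three_chord_pivotal` — the same with **`G_e = Σ_cyc ν_B·[m(A¹∩C¹) − m(A¹∩C⁰) − mA¹·ν_C] + Σ_cyc ν_B·[m(C⁰∩A¹) − m(C⁰∩A⁰)] + (2−t)·ν_Aν_Bν_C`**:
  for increasing events (`X⁰ ⊆ X¹`) the first bracket is `Cov(1_{A¹}, 1_{C¹∖C⁰})` (a SECTION against a PIVOTAL set — the only signed quantity), the second is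
  `m(C⁰ ∩ (A¹∖A⁰)) ≥ 0`;
* `sahiE_three_ge_sections_of_chord` — `0 ≤ t ≤ 1` and `G_e ≥ 0` give `E_3 ≥ (1−t)E_3(sections at 0) + tE_3(sections at 1)` (the local step of a coordinate induction that stays inside
  the type `Set ι`: sections are `e`-free events of the same cube).
All three are `ring` identities after one-coordinate conditioning (`ex_ind_eq_secAt`, `secAt_inter`).  Census facts that make the identity worth having (memo §4.32(d),(h)):
"some coordinate has `G_e ≥ 0`" is FALSE for general triples (master-conj's n = 6 antipodal-pairs triple, which is not doubly-terminal) but has no known failure on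
DOUBLY-TERMINAL triples (k ≤ 7), where it would give Kahn's C_3 with `SahiFrontierTransfer.sahiPositive_three_iff_doublyTerminal`.
-/

noncomputable section

open scoped Classical

namespace Summit.CriticalPhenomena.PercolationContinuityZ3.Theorems

namespace SahiCoordinateChord

open Finset Function
open Literature.Combinatorics.Sahi2008
open Literature.Probability.Percolation.DecisionTree (ind ind_of_mem ind_of_not_mem ind_nonneg)
open SahiCombDisjunct

variable {ι : Type} [Fintype ι] (p : ι → unitInterval) (e : ι) (A B C : Set (Set ι))

attribute [local simp] secAt_inter

/-- **THE CHORD IDENTITY of `E_3` along a coordinate (influence form)**, for three arbitrary events of a product measure. [this work] -/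
theorem sahiE_three_chord :
    sahiE (bernoulliWeight p) 3 ![ind A, ind B, ind C] =
      (1 - (p e : ℝ)) * sahiE (bernoulliWeight p) 3 ![ind (secAt e false A), ind (secAt e false B), ind (secAt e false C)]
      + (p e : ℝ) * sahiE (bernoulliWeight p) 3 ![ind (secAt e true A), ind (secAt e true B), ind (secAt e true C)]
      + (p e : ℝ) * (1 - (p e : ℝ)) *
        ( ( (ex (bernoulliWeight p) (ind (secAt e true A)) - ex (bernoulliWeight p) (ind (secAt e false A)))
              * (ex (bernoulliWeight p) (ind (secAt e true B ∩ secAt e true C)) - ex (bernoulliWeight p) (ind (secAt e false B ∩ secAt e false C)))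
            + (ex (bernoulliWeight p) (ind (secAt e true B)) - ex (bernoulliWeight p) (ind (secAt e false B)))
              * (ex (bernoulliWeight p) (ind (secAt e true A ∩ secAt e true C)) - ex (bernoulliWeight p) (ind (secAt e false A ∩ secAt e false C)))
            + (ex (bernoulliWeight p) (ind (secAt e true C)) - ex (bernoulliWeight p) (ind (secAt e false C)))
              * (ex (bernoulliWeight p) (ind (secAt e true A ∩ secAt e true B)) - ex (bernoulliWeight p) (ind (secAt e false A ∩ secAt e false B))) )
          - ( ((p e : ℝ) * ex (bernoulliWeight p) (ind (secAt e true A)) + (1 - (p e : ℝ)) * ex (bernoulliWeight p) (ind (secAt e false A)))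
              * (ex (bernoulliWeight p) (ind (secAt e true B)) - ex (bernoulliWeight p) (ind (secAt e false B)))
              * (ex (bernoulliWeight p) (ind (secAt e true C)) - ex (bernoulliWeight p) (ind (secAt e false C)))
            + ((p e : ℝ) * ex (bernoulliWeight p) (ind (secAt e true B)) + (1 - (p e : ℝ)) * ex (bernoulliWeight p) (ind (secAt e false B)))
              * (ex (bernoulliWeight p) (ind (secAt e true A)) - ex (bernoulliWeight p) (ind (secAt e false A)))
              * (ex (bernoulliWeight p) (ind (secAt e true C)) - ex (bernoulliWeight p) (ind (secAt e false C)))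
            + ((p e : ℝ) * ex (bernoulliWeight p) (ind (secAt e true C)) + (1 - (p e : ℝ)) * ex (bernoulliWeight p) (ind (secAt e false C)))
              * (ex (bernoulliWeight p) (ind (secAt e true A)) - ex (bernoulliWeight p) (ind (secAt e false A)))
              * (ex (bernoulliWeight p) (ind (secAt e true B)) - ex (bernoulliWeight p) (ind (secAt e false B))) )
          - ((1 - (p e : ℝ)) - (p e : ℝ))
              * (ex (bernoulliWeight p) (ind (secAt e true A)) - ex (bernoulliWeight p) (ind (secAt e false A)))
              * (ex (bernoulliWeight p) (ind (secAt e true B)) - ex (bernoulliWeight p) (ind (secAt e false B)))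
              * (ex (bernoulliWeight p) (ind (secAt e true C)) - ex (bernoulliWeight p) (ind (secAt e false C))) ) := by
  have hA := ex_ind_eq_secAt p e A
  have hB := ex_ind_eq_secAt p e B
  have hC := ex_ind_eq_secAt p e C
  have hAB : ex (bernoulliWeight p) (ind (A ∩ B)) = (p e : ℝ) * ex (bernoulliWeight p) (ind (secAt e true A ∩ secAt e true B)) +
      (1 - (p e : ℝ)) * ex (bernoulliWeight p) (ind (secAt e false A ∩ secAt e false B)) :=
    ex_ind_of_secAt p e (by simp) (by simp)
  have hAC : ex (bernoulliWeight p) (ind (A ∩ C)) = (p e : ℝ) * ex (bernoulliWeight p) (ind (secAt e true A ∩ secAt e true C)) +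
      (1 - (p e : ℝ)) * ex (bernoulliWeight p) (ind (secAt e false A ∩ secAt e false C)) :=
    ex_ind_of_secAt p e (by simp) (by simp)
  have hBC : ex (bernoulliWeight p) (ind (B ∩ C)) = (p e : ℝ) * ex (bernoulliWeight p) (ind (secAt e true B ∩ secAt e true C)) +
      (1 - (p e : ℝ)) * ex (bernoulliWeight p) (ind (secAt e false B ∩ secAt e false C)) :=
    ex_ind_of_secAt p e (by simp) (by simp)
  have hABC : ex (bernoulliWeight p) (ind (A ∩ B ∩ C)) =
      (p e : ℝ) * ex (bernoulliWeight p) (ind (secAt e true A ∩ secAt e true B ∩ secAt e true C)) +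
        (1 - (p e : ℝ)) * ex (bernoulliWeight p) (ind (secAt e false A ∩ secAt e false B ∩ secAt e false C)) :=
    ex_ind_of_secAt p e (by simp) (by simp)
  rw [sahiE_three, sahiE_three, sahiE_three]
  simp only [ind_mul_ind_eq_inter]
  rw [hA, hB, hC, hAB, hAC, hBC, hABC]
  ring

/-- **THE CHORD IDENTITY in pivotal-set form**: the remainder regrouped as
`Σ_cyc ν_B·[m(A¹∩C¹) − m(A¹∩C⁰) − mA¹·ν_C] + Σ_cyc ν_B·[m(C⁰∩A¹) − m(C⁰∩A⁰)] + (2−t)·ν_Aν_Bν_C` (for increasing events: section-vs-pivotal-set covariances,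
masses of `C⁰ ∩ (A¹∖A⁰)`, and the triple influence product). [this work] -/
theorem sahiE_three_chord_pivotal :
    sahiE (bernoulliWeight p) 3 ![ind A, ind B, ind C] =
      (1 - (p e : ℝ)) * sahiE (bernoulliWeight p) 3 ![ind (secAt e false A), ind (secAt e false B), ind (secAt e false C)]
      + (p e : ℝ) * sahiE (bernoulliWeight p) 3 ![ind (secAt e true A), ind (secAt e true B), ind (secAt e true C)]
      + (p e : ℝ) * (1 - (p e : ℝ)) *
        ( ( (ex (bernoulliWeight p) (ind (secAt e true B)) - ex (bernoulliWeight p) (ind (secAt e false B)))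
              * (ex (bernoulliWeight p) (ind (secAt e true A ∩ secAt e true C)) - ex (bernoulliWeight p) (ind (secAt e true A ∩ secAt e false C))
                  - ex (bernoulliWeight p) (ind (secAt e true A))
                    * (ex (bernoulliWeight p) (ind (secAt e true C)) - ex (bernoulliWeight p) (ind (secAt e false C))))
            + (ex (bernoulliWeight p) (ind (secAt e true C)) - ex (bernoulliWeight p) (ind (secAt e false C)))
              * (ex (bernoulliWeight p) (ind (secAt e true B ∩ secAt e true A)) - ex (bernoulliWeight p) (ind (secAt e true B ∩ secAt e false A))
                  - ex (bernoulliWeight p) (ind (secAt e true B))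
                    * (ex (bernoulliWeight p) (ind (secAt e true A)) - ex (bernoulliWeight p) (ind (secAt e false A))))
            + (ex (bernoulliWeight p) (ind (secAt e true A)) - ex (bernoulliWeight p) (ind (secAt e false A)))
              * (ex (bernoulliWeight p) (ind (secAt e true C ∩ secAt e true B)) - ex (bernoulliWeight p) (ind (secAt e true C ∩ secAt e false B))
                  - ex (bernoulliWeight p) (ind (secAt e true C))
                    * (ex (bernoulliWeight p) (ind (secAt e true B)) - ex (bernoulliWeight p) (ind (secAt e false B)))) )
          + ( (ex (bernoulliWeight p) (ind (secAt e true B)) - ex (bernoulliWeight p) (ind (secAt e false B)))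
              * (ex (bernoulliWeight p) (ind (secAt e false C ∩ secAt e true A)) - ex (bernoulliWeight p) (ind (secAt e false C ∩ secAt e false A)))
            + (ex (bernoulliWeight p) (ind (secAt e true C)) - ex (bernoulliWeight p) (ind (secAt e false C)))
              * (ex (bernoulliWeight p) (ind (secAt e false A ∩ secAt e true B)) - ex (bernoulliWeight p) (ind (secAt e false A ∩ secAt e false B)))
            + (ex (bernoulliWeight p) (ind (secAt e true A)) - ex (bernoulliWeight p) (ind (secAt e false A)))
              * (ex (bernoulliWeight p) (ind (secAt e false B ∩ secAt e true C)) - ex (bernoulliWeight p) (ind (secAt e false B ∩ secAt e false C))) )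
          + (2 - (p e : ℝ))
              * (ex (bernoulliWeight p) (ind (secAt e true A)) - ex (bernoulliWeight p) (ind (secAt e false A)))
              * (ex (bernoulliWeight p) (ind (secAt e true B)) - ex (bernoulliWeight p) (ind (secAt e false B)))
              * (ex (bernoulliWeight p) (ind (secAt e true C)) - ex (bernoulliWeight p) (ind (secAt e false C))) ) := by
  rw [sahiE_three_chord p e A B C]
  -- mixed sections of intersections: `m(X¹ ∩ Y⁰)` terms cancel in pairs once intersections are commuted
  have h1 : ex (bernoulliWeight p) (ind (secAt e true B ∩ secAt e true A)) = ex (bernoulliWeight p) (ind (secAt e true A ∩ secAt e true B)) := by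
    rw [Set.inter_comm]
  have h2 : ex (bernoulliWeight p) (ind (secAt e true C ∩ secAt e true B)) = ex (bernoulliWeight p) (ind (secAt e true B ∩ secAt e true C)) := by
    rw [Set.inter_comm]
  have h3 : ex (bernoulliWeight p) (ind (secAt e false C ∩ secAt e true A)) = ex (bernoulliWeight p) (ind (secAt e true A ∩ secAt e false C)) := by
    rw [Set.inter_comm]
  have h4 : ex (bernoulliWeight p) (ind (secAt e false A ∩ secAt e true B)) = ex (bernoulliWeight p) (ind (secAt e true B ∩ secAt e false A)) := by
    rw [Set.inter_comm]
  have h5 : ex (bernoulliWeight p) (ind (secAt e false B ∩ secAt e true C)) = ex (bernoulliWeight p) (ind (secAt e true C ∩ secAt e false B)) := by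
    rw [Set.inter_comm]
  have h6 : ex (bernoulliWeight p) (ind (secAt e false C ∩ secAt e false A)) = ex (bernoulliWeight p) (ind (secAt e false A ∩ secAt e false C)) := by
    rw [Set.inter_comm]
  rw [h1, h2, h3, h4, h5, h6]
  ring

/-- **The local step**: `0 ≤ t ≤ 1` and a nonnegative chord remainder `G_e` give `E_3 ≥ (1−t)·E_3(sections at 0) + t·E_3(sections at 1)`. [this work] -/
theorem sahiE_three_ge_sections_of_chord
    (hG : 0 ≤
        ( (ex (bernoulliWeight p) (ind (secAt e true A)) - ex (bernoulliWeight p) (ind (secAt e false A)))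
              * (ex (bernoulliWeight p) (ind (secAt e true B ∩ secAt e true C)) - ex (bernoulliWeight p) (ind (secAt e false B ∩ secAt e false C)))
            + (ex (bernoulliWeight p) (ind (secAt e true B)) - ex (bernoulliWeight p) (ind (secAt e false B)))
              * (ex (bernoulliWeight p) (ind (secAt e true A ∩ secAt e true C)) - ex (bernoulliWeight p) (ind (secAt e false A ∩ secAt e false C)))
            + (ex (bernoulliWeight p) (ind (secAt e true C)) - ex (bernoulliWeight p) (ind (secAt e false C)))
              * (ex (bernoulliWeight p) (ind (secAt e true A ∩ secAt e true B)) - ex (bernoulliWeight p) (ind (secAt e false A ∩ secAt e false B))) )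
          - ( ((p e : ℝ) * ex (bernoulliWeight p) (ind (secAt e true A)) + (1 - (p e : ℝ)) * ex (bernoulliWeight p) (ind (secAt e false A)))
              * (ex (bernoulliWeight p) (ind (secAt e true B)) - ex (bernoulliWeight p) (ind (secAt e false B)))
              * (ex (bernoulliWeight p) (ind (secAt e true C)) - ex (bernoulliWeight p) (ind (secAt e false C)))
            + ((p e : ℝ) * ex (bernoulliWeight p) (ind (secAt e true B)) + (1 - (p e : ℝ)) * ex (bernoulliWeight p) (ind (secAt e false B)))
              * (ex (bernoulliWeight p) (ind (secAt e true A)) - ex (bernoulliWeight p) (ind (secAt e false A)))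
              * (ex (bernoulliWeight p) (ind (secAt e true C)) - ex (bernoulliWeight p) (ind (secAt e false C)))
            + ((p e : ℝ) * ex (bernoulliWeight p) (ind (secAt e true C)) + (1 - (p e : ℝ)) * ex (bernoulliWeight p) (ind (secAt e false C)))
              * (ex (bernoulliWeight p) (ind (secAt e true A)) - ex (bernoulliWeight p) (ind (secAt e false A)))
              * (ex (bernoulliWeight p) (ind (secAt e true B)) - ex (bernoulliWeight p) (ind (secAt e false B))) )
          - ((1 - (p e : ℝ)) - (p e : ℝ))
              * (ex (bernoulliWeight p) (ind (secAt e true A)) - ex (bernoulliWeight p) (ind (secAt e false A)))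
              * (ex (bernoulliWeight p) (ind (secAt e true B)) - ex (bernoulliWeight p) (ind (secAt e false B)))
              * (ex (bernoulliWeight p) (ind (secAt e true C)) - ex (bernoulliWeight p) (ind (secAt e false C)))) :
    (1 - (p e : ℝ)) * sahiE (bernoulliWeight p) 3 ![ind (secAt e false A), ind (secAt e false B), ind (secAt e false C)]
      + (p e : ℝ) * sahiE (bernoulliWeight p) 3 ![ind (secAt e true A), ind (secAt e true B), ind (secAt e true C)]
      ≤ sahiE (bernoulliWeight p) 3 ![ind A, ind B, ind C] := by
  rw [sahiE_three_chord p e A B C]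
  have hp0 : 0 ≤ (p e : ℝ) := (p e).2.1
  have hp1 : (p e : ℝ) ≤ 1 := (p e).2.2
  have hpq : 0 ≤ (p e : ℝ) * (1 - (p e : ℝ)) := mul_nonneg hp0 (by linarith)
  nlinarith [mul_nonneg hpq hG]

end SahiCoordinateChord

end Summit.CriticalPhenomena.PercolationContinuityZ3.Theorems
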